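import Summits.AnomalousDissipation.AnomalousDissipation.Theses.VirtualDissipation
import Literature.Analysis.FunctionSpaces.TorusInverseLaplacianCalculus

/-!
# Negative knowledge for crux `LambRigidGP` (stmt-AnomalousDissipation-15150, route `VirtualDissipation`):
# the residual cap `R ≤ δ₀` is load-bearing, and every witness has `δ₀ < ‖∇f_GP‖₂ / (4π²)`

The crux `Summit.AnomalousDissipation.AnomalousDissipation.Theses.VirtualDissipation.LambRigidGP` reads:
`∃ E ≥ 2, c > 0, δ₀ > 0`, every smooth divergence-free mean-zero `u` on `T³` with `∫|u|² ≤ E` and every residual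
bound `R ∈ [0, δ₀]` of `w ↦ ∫⟪(u·∇)u − f_GP, w⟫` (dual to `√(gradNormSq w)` over smooth div-free mean-zero `w`) pays
`c ≤ R √(gradNormSq u)`, with the pinned Galloway–Proctor force
`f_GP = stokesMode e₂ e₀ false + stokesMode e₀ e₁ false + stokesMode e₁ e₂ false = (sin 2πx₂, sin 2πx₀, sin 2πx₁)`.

The ZERO FIELD is an admissible competitor of energy `0 ≤ E`.  Its steady-Euler residual is `−f_GP`, and since `f_GP` is a
first-shell Stokes eigenfield (`Δ f_GP = −4π² f_GP`, `Torus.laplacian_stokesMode`) the landed Green–Cauchy–Schwarz bound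
`PhantomFloor.abs_integral_inner_laplacian_le` gives the residual bound
`R₀ := √(gradNormSq f_GP) / (4π²)` (`= ‖f_GP‖_{V'} = √6/(4π) ≈ 0.195` numerically), while `√(gradNormSq 0) = 0` pays no
virtual dissipation.  Consequences (pure proofs over landed lemmas, no definitions, no notation):

* `lambRigidGP_false_without_cap` — the crux with the clause `R ≤ δ₀` deleted is FALSE (witness `u = 0`, `R = R₀`):
  any proof of the crux must use the residual cap;
* `lambRigidGP_cap_lt` — every `(E, c, δ₀)` satisfying the crux body (any `E ≥ 0`, `c > 0`) has `δ₀ < R₀`: the cap must sit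
  strictly below the dual norm of the force (the route header's "vacuity threshold", kernel-checked);
* `lambRigidGP_no_smooth_steady_state` — the `R = 0` reading: the crux forbids every exact smooth admissible steady Euler
  state of `f_GP` in the closed energy ball of level `2`.

The force-generic part is stated for an arbitrary smooth eigenfield `F` (`Δ F = −μ F`, `μ > 0`).
-/

noncomputable section

open MeasureTheory
open scoped Real InnerProductSpace

-- `Summit.<Summit>.<Problem>` is the tree's mandated summit-side namespace (CONVENTIONS §2); single-conjunct summit.
set_option linter.dupNamespace false

namespace Summit.AnomalousDissipation.AnomalousDissipation.Theorems.LambRigidGP.Negative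

open Literature.Analysis.FunctionSpaces Literature.Analysis.FluidPDE

/-! ## The zero field -/

/-- The zero field is smooth (private copy of a folklore one-liner; public copies live in unrelated Theorems files). -/
private theorem isSmooth_zero : Torus.IsSmooth (0 : UnitAddTorus (Fin 3) → EuclideanSpace ℝ (Fin 3)) :=
  Torus.isSmooth_const (0 : EuclideanSpace ℝ (Fin 3))

/-- The zero field is divergence free. -/
private theorem isDivFree_zero : Torus.IsDivFree (0 : UnitAddTorus (Fin 3) → EuclideanSpace ℝ (Fin 3)) := by
  intro x
  simp [Torus.divergence, Torus.partialDeriv, Torus.lineDeriv]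

/-- The zero field has zero mean. -/
private theorem hasZeroMean_zero : Torus.HasZeroMean (0 : UnitAddTorus (Fin 3) → EuclideanSpace ℝ (Fin 3)) := by
  simp [Torus.HasZeroMean]

/-- `gradNormSq 0 = 0`: the zero field pays no roughness. -/
private theorem gradNormSq_zero : Torus.gradNormSq (0 : UnitAddTorus (Fin 3) → EuclideanSpace ℝ (Fin 3)) = 0 := by
  simp [Torus.gradNormSq, Torus.partialDeriv, Torus.lineDeriv]

/-- `(0·∇)0 = 0`. -/
private theorem convect_zero_zero (x : UnitAddTorus (Fin 3)) :
    Torus.convect (0 : UnitAddTorus (Fin 3) → EuclideanSpace ℝ (Fin 3))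
      (0 : UnitAddTorus (Fin 3) → EuclideanSpace ℝ (Fin 3)) x = 0 := by
  unfold Torus.convect Torus.fderiv Torus.liftAt
  simp

/-! ## A smooth eigenfield `Δ F = -μ F` has dual-enstrophy norm `≤ √(gradNormSq F)/μ`, attained against the zero field -/

/-- **Dual-enstrophy bound of an eigenfield**: if `F` is smooth with `Δ F = -μ F` pointwise and `μ > 0`, then
`|∫⟪F, w⟫| ≤ (√(gradNormSq F)/μ) · √(gradNormSq w)` for every smooth `w` (Green's identity + Cauchy–Schwarz, the landed
`PhantomFloor.abs_integral_inner_laplacian_le`). -/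
theorem abs_integral_inner_le_of_laplacian_eq {F w : UnitAddTorus (Fin 3) → EuclideanSpace ℝ (Fin 3)} {μ : ℝ}
    (hF : Torus.IsSmooth F) (hΔ : ∀ x, Torus.laplacian F x = -μ • F x) (hμ : 0 < μ) (hw : Torus.IsSmooth w) :
    |∫ x, ⟪F x, w x⟫_ℝ| ≤ Real.sqrt (Torus.gradNormSq F) / μ * Real.sqrt (Torus.gradNormSq w) := by
  have hpt : (fun x => ⟪F x, w x⟫_ℝ) = fun x => (-μ)⁻¹ * ⟪w x, Torus.laplacian F x⟫_ℝ := by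
    funext x
    rw [hΔ x, inner_smul_right, real_inner_comm (w x), ← mul_assoc, inv_mul_cancel₀ (neg_ne_zero.mpr hμ.ne'), one_mul]
  rw [hpt, MeasureTheory.integral_const_mul, abs_mul, abs_inv, abs_neg, abs_of_pos hμ]
  have key := Summit.AnomalousDissipation.AnomalousDissipation.Theorems.PhantomFloor.abs_integral_inner_laplacian_le hw hF
  calc μ⁻¹ * |∫ x, ⟪w x, Torus.laplacian F x⟫_ℝ|
      ≤ μ⁻¹ * (Real.sqrt (Torus.gradNormSq w) * Real.sqrt (Torus.gradNormSq F)) := by gcongr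
    _ = Real.sqrt (Torus.gradNormSq F) / μ * Real.sqrt (Torus.gradNormSq w) := by ring

/-- **`R₀ = √(gradNormSq F)/μ` is a residual bound for the zero field** against the force `F` (its steady-Euler residual is
`−F`). -/
theorem residualBound_zero_of_laplacian_eq {F w : UnitAddTorus (Fin 3) → EuclideanSpace ℝ (Fin 3)} {μ : ℝ}
    (hF : Torus.IsSmooth F) (hΔ : ∀ x, Torus.laplacian F x = -μ • F x) (hμ : 0 < μ) (hw : Torus.IsSmooth w) :
    |∫ x, ⟪Torus.convect (0 : UnitAddTorus (Fin 3) → EuclideanSpace ℝ (Fin 3))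
        (0 : UnitAddTorus (Fin 3) → EuclideanSpace ℝ (Fin 3)) x - F x, w x⟫_ℝ| ≤
      Real.sqrt (Torus.gradNormSq F) / μ * Real.sqrt (Torus.gradNormSq w) := by
  simp_rw [convect_zero_zero, zero_sub, inner_neg_left, integral_neg, abs_neg]
  exact abs_integral_inner_le_of_laplacian_eq hF hΔ hμ hw

/-- **No cap, no rigidity** (force-generic core): for a smooth eigenfield force `F` (`Δ F = -μ F`, `μ > 0`), no level `E ≥ 0`
and constant `c > 0` make "every admissible `u` with `∫|u|² ≤ E` and every residual bound `R ≥ 0` pay `c ≤ R √(gradNormSq u)`"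
true once residual bounds up to `R₀ = √(gradNormSq F)/μ` are admitted: the zero field with `R = R₀ ≤ δ₀` pays nothing. -/
theorem not_rigid_of_cap_ge {F : UnitAddTorus (Fin 3) → EuclideanSpace ℝ (Fin 3)} {μ E c δ₀ : ℝ}
    (hF : Torus.IsSmooth F) (hΔ : ∀ x, Torus.laplacian F x = -μ • F x) (hμ : 0 < μ) (hE : 0 ≤ E) (hc : 0 < c)
    (hδ : Real.sqrt (Torus.gradNormSq F) / μ ≤ δ₀)
    (h : ∀ u : UnitAddTorus (Fin 3) → EuclideanSpace ℝ (Fin 3),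
        Torus.IsSmooth u → Torus.IsDivFree u → Torus.HasZeroMean u → ∫ x, ‖u x‖ ^ 2 ≤ E → ∀ R : ℝ, 0 ≤ R →
        (∀ w : UnitAddTorus (Fin 3) → EuclideanSpace ℝ (Fin 3), Torus.IsSmooth w → Torus.IsDivFree w → Torus.HasZeroMean w →
          |∫ x, ⟪Torus.convect u u x - F x, w x⟫_ℝ| ≤ R * Real.sqrt (Torus.gradNormSq w)) →
        R ≤ δ₀ → c ≤ R * Real.sqrt (Torus.gradNormSq u)) :
    False := by
  have hE0 : ∫ x, ‖(0 : UnitAddTorus (Fin 3) → EuclideanSpace ℝ (Fin 3)) x‖ ^ 2 ≤ E := by simpa using hE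
  have h0 := h 0 isSmooth_zero isDivFree_zero hasZeroMean_zero hE0 (Real.sqrt (Torus.gradNormSq F) / μ) (by positivity)
    (fun w hw _ _ => residualBound_zero_of_laplacian_eq hF hΔ hμ hw) hδ
  rw [gradNormSq_zero, Real.sqrt_zero, mul_zero] at h0
  exact absurd h0 (not_le.mpr hc)

/-! ## `f_GP` is a first-shell Stokes eigenfield: `Δ f_GP = -4π² f_GP` -/

/-- The Stokes eigenvalue of a unit lattice vector is `4π²`. -/
theorem stokesEigenvalue_single_one (i : Fin 3) :
    Torus.stokesEigenvalue (Pi.single i (1 : ℤ) : Fin 3 → ℤ) = 4 * π ^ 2 := by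
  unfold Torus.stokesEigenvalue Torus.freqNormSq
  fin_cases i <;> simp [Fin.sum_univ_three]

/-- `f_GP` is smooth (landed `stub_gpAdmissible`). -/
theorem isSmooth_fGP : Torus.IsSmooth (fun x : UnitAddTorus (Fin 3) =>
    (Torus.stokesMode (Pi.single (2 : Fin 3) (1 : ℤ)) (EuclideanSpace.single (0 : Fin 3) (1 : ℝ)) false x +
      Torus.stokesMode (Pi.single (0 : Fin 3) (1 : ℤ)) (EuclideanSpace.single (1 : Fin 3) (1 : ℝ)) false x +
      Torus.stokesMode (Pi.single (1 : Fin 3) (1 : ℤ)) (EuclideanSpace.single (2 : Fin 3) (1 : ℝ)) false x :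
      EuclideanSpace ℝ (Fin 3))) :=
  Summit.AnomalousDissipation.AnomalousDissipation.Theorems.SteadyStatesLoudBounded.GpAdmissible.stub_gpAdmissible.1

/-- **`Δ f_GP = -4π² f_GP`** pointwise: each of the three Stokes modes has frequency of length `1`. -/
theorem laplacian_fGP (x : UnitAddTorus (Fin 3)) :
    Torus.laplacian (fun y : UnitAddTorus (Fin 3) =>
      (Torus.stokesMode (Pi.single (2 : Fin 3) (1 : ℤ)) (EuclideanSpace.single (0 : Fin 3) (1 : ℝ)) false y +
        Torus.stokesMode (Pi.single (0 : Fin 3) (1 : ℤ)) (EuclideanSpace.single (1 : Fin 3) (1 : ℝ)) false y +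
        Torus.stokesMode (Pi.single (1 : Fin 3) (1 : ℤ)) (EuclideanSpace.single (2 : Fin 3) (1 : ℝ)) false y :
        EuclideanSpace ℝ (Fin 3))) x =
    -(4 * π ^ 2) • (Torus.stokesMode (Pi.single (2 : Fin 3) (1 : ℤ)) (EuclideanSpace.single (0 : Fin 3) (1 : ℝ)) false x +
        Torus.stokesMode (Pi.single (0 : Fin 3) (1 : ℤ)) (EuclideanSpace.single (1 : Fin 3) (1 : ℝ)) false x +
        Torus.stokesMode (Pi.single (1 : Fin 3) (1 : ℤ)) (EuclideanSpace.single (2 : Fin 3) (1 : ℝ)) false x :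
        EuclideanSpace ℝ (Fin 3)) := by
  set m₁ := Torus.stokesMode (Pi.single (2 : Fin 3) (1 : ℤ)) (EuclideanSpace.single (0 : Fin 3) (1 : ℝ)) false with hm₁
  set m₂ := Torus.stokesMode (Pi.single (0 : Fin 3) (1 : ℤ)) (EuclideanSpace.single (1 : Fin 3) (1 : ℝ)) false with hm₂
  set m₃ := Torus.stokesMode (Pi.single (1 : Fin 3) (1 : ℤ)) (EuclideanSpace.single (2 : Fin 3) (1 : ℝ)) false with hm₃
  have h1 : Torus.IsSmooth (⇑m₁ : UnitAddTorus (Fin 3) → EuclideanSpace ℝ (Fin 3)) := Torus.isSmooth_stokesMode _ _ _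
  have h2 : Torus.IsSmooth (⇑m₂ : UnitAddTorus (Fin 3) → EuclideanSpace ℝ (Fin 3)) := Torus.isSmooth_stokesMode _ _ _
  have h3 : Torus.IsSmooth (⇑m₃ : UnitAddTorus (Fin 3) → EuclideanSpace ℝ (Fin 3)) := Torus.isSmooth_stokesMode _ _ _
  have e : (fun y : UnitAddTorus (Fin 3) => (m₁ y + m₂ y + m₃ y : EuclideanSpace ℝ (Fin 3))) = (⇑m₁ + ⇑m₂) + ⇑m₃ := rfl
  rw [e, Torus.laplacian_add_apply (h1.add h2) h3, Torus.laplacian_add_apply h1 h2, hm₁, hm₂, hm₃,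
    Torus.laplacian_stokesMode, Torus.laplacian_stokesMode, Torus.laplacian_stokesMode,
    stokesEigenvalue_single_one, stokesEigenvalue_single_one, stokesEigenvalue_single_one, smul_add, smul_add]

/-! ## The negative lemmas for the crux -/

/-- **The residual cap is load-bearing** (`LambRigidGP` without the clause `R ≤ δ₀` is false): with the cap deleted the zero
field `u = 0` (admissible, energy `0 ≤ E`) and its residual bound `R₀ = √(gradNormSq f_GP)/(4π²)` would have to pay
`c ≤ R₀ · √(gradNormSq 0) = 0 < c`.  Any proof of the crux must use `R ≤ δ₀`. -/
theorem lambRigidGP_false_without_cap :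
    ¬ (∃ E c : ℝ, 2 ≤ E ∧ 0 < c ∧ ∀ u : UnitAddTorus (Fin 3) → EuclideanSpace ℝ (Fin 3),
        Literature.Analysis.FunctionSpaces.Torus.IsSmooth u → Literature.Analysis.FunctionSpaces.Torus.IsDivFree u →
        Literature.Analysis.FunctionSpaces.Torus.HasZeroMean u → ∫ x, ‖u x‖ ^ 2 ≤ E → ∀ R : ℝ, 0 ≤ R →
        (∀ w : UnitAddTorus (Fin 3) → EuclideanSpace ℝ (Fin 3), Literature.Analysis.FunctionSpaces.Torus.IsSmooth w →
          Literature.Analysis.FunctionSpaces.Torus.IsDivFree w → Literature.Analysis.FunctionSpaces.Torus.HasZeroMean w →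
          |∫ x, inner ℝ (Literature.Analysis.FunctionSpaces.Torus.convect u u x -
              (Literature.Analysis.FluidPDE.Torus.stokesMode (Pi.single (2 : Fin 3) (1 : ℤ)) (EuclideanSpace.single (0 : Fin 3) (1 : ℝ)) false x +
                Literature.Analysis.FluidPDE.Torus.stokesMode (Pi.single (0 : Fin 3) (1 : ℤ)) (EuclideanSpace.single (1 : Fin 3) (1 : ℝ)) false x +
                Literature.Analysis.FluidPDE.Torus.stokesMode (Pi.single (1 : Fin 3) (1 : ℤ)) (EuclideanSpace.single (2 : Fin 3) (1 : ℝ)) false x :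
                EuclideanSpace ℝ (Fin 3))) (w x)| ≤
            R * Real.sqrt (Literature.Analysis.FunctionSpaces.Torus.gradNormSq w)) →
        c ≤ R * Real.sqrt (Literature.Analysis.FunctionSpaces.Torus.gradNormSq u)) := by
  rintro ⟨E, c, hE, hc, h⟩
  refine not_rigid_of_cap_ge (μ := 4 * π ^ 2) (E := E) isSmooth_fGP laplacian_fGP (by positivity) (by linarith) hc le_rfl ?_
  intro u hu hdiv hzero hEu R hR hres _
  exact h u hu hdiv hzero hEu R hR hres

/-- **Calibration of the cap**: if `(E, c, δ₀)` satisfies the body of `LambRigidGP` (for ANY level `E ≥ 0` and `c > 0`), then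
`δ₀ < R₀ = √(gradNormSq f_GP)/(4π²)` (`= √6/(4π) ≈ 0.195`): otherwise `R₀ ≤ δ₀` is an admissible residual bound of the zero
field and the body yields `c ≤ 0`.  In particular the crux can only hold with a residual cap strictly below `‖f_GP‖_{V'}`. -/
theorem lambRigidGP_cap_lt {E c δ₀ : ℝ} (hE : 0 ≤ E) (hc : 0 < c)
    (h : ∀ u : UnitAddTorus (Fin 3) → EuclideanSpace ℝ (Fin 3),
        Literature.Analysis.FunctionSpaces.Torus.IsSmooth u → Literature.Analysis.FunctionSpaces.Torus.IsDivFree u →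
        Literature.Analysis.FunctionSpaces.Torus.HasZeroMean u → ∫ x, ‖u x‖ ^ 2 ≤ E → ∀ R : ℝ, 0 ≤ R →
        (∀ w : UnitAddTorus (Fin 3) → EuclideanSpace ℝ (Fin 3), Literature.Analysis.FunctionSpaces.Torus.IsSmooth w →
          Literature.Analysis.FunctionSpaces.Torus.IsDivFree w → Literature.Analysis.FunctionSpaces.Torus.HasZeroMean w →
          |∫ x, inner ℝ (Literature.Analysis.FunctionSpaces.Torus.convect u u x -
              (Literature.Analysis.FluidPDE.Torus.stokesMode (Pi.single (2 : Fin 3) (1 : ℤ)) (EuclideanSpace.single (0 : Fin 3) (1 : ℝ)) false x +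
                Literature.Analysis.FluidPDE.Torus.stokesMode (Pi.single (0 : Fin 3) (1 : ℤ)) (EuclideanSpace.single (1 : Fin 3) (1 : ℝ)) false x +
                Literature.Analysis.FluidPDE.Torus.stokesMode (Pi.single (1 : Fin 3) (1 : ℤ)) (EuclideanSpace.single (2 : Fin 3) (1 : ℝ)) false x :
                EuclideanSpace ℝ (Fin 3))) (w x)| ≤
            R * Real.sqrt (Literature.Analysis.FunctionSpaces.Torus.gradNormSq w)) →
        R ≤ δ₀ → c ≤ R * Real.sqrt (Literature.Analysis.FunctionSpaces.Torus.gradNormSq u)) :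
    δ₀ < Real.sqrt (Literature.Analysis.FunctionSpaces.Torus.gradNormSq (fun y : UnitAddTorus (Fin 3) =>
      (Literature.Analysis.FluidPDE.Torus.stokesMode (Pi.single (2 : Fin 3) (1 : ℤ)) (EuclideanSpace.single (0 : Fin 3) (1 : ℝ)) false y +
        Literature.Analysis.FluidPDE.Torus.stokesMode (Pi.single (0 : Fin 3) (1 : ℤ)) (EuclideanSpace.single (1 : Fin 3) (1 : ℝ)) false y +
        Literature.Analysis.FluidPDE.Torus.stokesMode (Pi.single (1 : Fin 3) (1 : ℤ)) (EuclideanSpace.single (2 : Fin 3) (1 : ℝ)) false y :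
        EuclideanSpace ℝ (Fin 3)))) / (4 * π ^ 2) := by
  by_contra hle
  rw [not_lt] at hle
  exact not_rigid_of_cap_ge isSmooth_fGP laplacian_fGP (by positivity) hE hc hle h

/-- **Corollary for the crux as stated**: every witness `(E, c, δ₀)` of `LambRigidGP` has `δ₀ < √(gradNormSq f_GP)/(4π²)`. -/
theorem lambRigidGP_witness_cap_lt
    (h : Summit.AnomalousDissipation.AnomalousDissipation.Theses.VirtualDissipation.LambRigidGP) :
    ∃ E c δ₀ : ℝ, 2 ≤ E ∧ 0 < c ∧ 0 < δ₀ ∧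
      δ₀ < Real.sqrt (Literature.Analysis.FunctionSpaces.Torus.gradNormSq (fun y : UnitAddTorus (Fin 3) =>
        (Literature.Analysis.FluidPDE.Torus.stokesMode (Pi.single (2 : Fin 3) (1 : ℤ)) (EuclideanSpace.single (0 : Fin 3) (1 : ℝ)) false y +
          Literature.Analysis.FluidPDE.Torus.stokesMode (Pi.single (0 : Fin 3) (1 : ℤ)) (EuclideanSpace.single (1 : Fin 3) (1 : ℝ)) false y +
          Literature.Analysis.FluidPDE.Torus.stokesMode (Pi.single (1 : Fin 3) (1 : ℤ)) (EuclideanSpace.single (2 : Fin 3) (1 : ℝ)) false y :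
          EuclideanSpace ℝ (Fin 3)))) / (4 * π ^ 2) := by
  obtain ⟨E, c, δ₀, hE, hc, hδ, hbody⟩ := h
  exact ⟨E, c, δ₀, hE, hc, hδ, lambRigidGP_cap_lt (by linarith) hc hbody⟩

/-- **The `R = 0` reading of the crux**: `LambRigidGP` forbids every EXACT smooth divergence-free mean-zero steady Euler
state of `f_GP` in the closed energy ball of level `2` (tested against smooth div-free mean-zero fields) — take the admissible
residual bound `R = 0 ≤ δ₀`, which would have to pay `c ≤ 0`.  (The dead-line census found none of degree `≤ 7`; this is the
exact-solution enemy `Q` of the birth skeleton restricted to smooth states.) -/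
theorem lambRigidGP_no_smooth_steady_state
    (h : Summit.AnomalousDissipation.AnomalousDissipation.Theses.VirtualDissipation.LambRigidGP)
    {u : UnitAddTorus (Fin 3) → EuclideanSpace ℝ (Fin 3)} (hu : Torus.IsSmooth u) (hdiv : Torus.IsDivFree u)
    (hzero : Torus.HasZeroMean u) (hE : ∫ x, ‖u x‖ ^ 2 ≤ 2)
    (hsteady : ∀ w : UnitAddTorus (Fin 3) → EuclideanSpace ℝ (Fin 3), Torus.IsSmooth w → Torus.IsDivFree w →
      Torus.HasZeroMean w →
      ∫ x, ⟪Torus.convect u u x -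
          (Torus.stokesMode (Pi.single (2 : Fin 3) (1 : ℤ)) (EuclideanSpace.single (0 : Fin 3) (1 : ℝ)) false x +
            Torus.stokesMode (Pi.single (0 : Fin 3) (1 : ℤ)) (EuclideanSpace.single (1 : Fin 3) (1 : ℝ)) false x +
            Torus.stokesMode (Pi.single (1 : Fin 3) (1 : ℤ)) (EuclideanSpace.single (2 : Fin 3) (1 : ℝ)) false x :
            EuclideanSpace ℝ (Fin 3)), w x⟫_ℝ = 0) :
    False := by
  obtain ⟨E, c, δ₀, hE2, hc, hδ, hbody⟩ := h
  have h0 := hbody u hu hdiv hzero (hE.trans hE2) 0 le_rfl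
    (fun w hw hwd hwz => by rw [hsteady w hw hwd hwz, abs_zero, zero_mul]) hδ.le
  rw [zero_mul] at h0
  exact absurd h0 (not_le.mpr hc)

end Summit.AnomalousDissipation.AnomalousDissipation.Theorems.LambRigidGP.Negative

end
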